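import Mathlib
import HarnessLib

/-!
# Yorke's lower bound `p ≥ 2π/L` for the periods of periodic solutions of a Lipschitz ODE (Yorke 1969)

Topic `Literature/Analysis/ODE`. Named fact (D-0014), vendored AS PRINTED, plus its proved
specialisation to `ℝ³`. It grounds the support item
`Summit.NavierStokesRegularity.NavierStokesRegularity.Theses.VortexLineClock.YorkePeriodBound`
(route NavierStokesRegularity/VortexLineClock), which is the case `n = 3`, `Ω = ℝ³` of the fact
(`yorke1969_periodBound_fin3`, proved below from the fact: the item's non-stationarity clause
`F (x 0) ≠ 0` implies that the solution is nonconstant). The same bound is the closing step of that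
route's items `ProfileClockNoCycle` and `EulerClockBound` (periods of closed vortex lines).

Source: J. A. Yorke, *Periods of periodic solutions and the Lipschitz constant*, Proc. Amer.
Math. Soc. 22 (1969) 509–512, doi:10.1090/s0002-9939-1969-0245916-7 (read 2026-08-15, pp. 509–511).
Printed (p. 509, verbatim up to notation): "Let `x(t)` be a nonconstant periodic solution with
period `p` of (1) `x' = F(x)`, where `F : Ω → Rⁿ` for some set `Ω ⊂ Rⁿ`. Let `‖·‖` denote the
Euclidean norm. We say `F` has (Euclidean) Lipschitz constant `L` if (2)
`‖F(x₁) − F(x₂)‖ ≤ L‖x₁ − x₂‖` for each `x₁, x₂ ∈ Ω`. […] **Theorem.** If `F` satisfies (2), then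
`p ≥ 2π/L`." Sharpness (ibid.): for `F(x) = (−Lx₂, Lx₁, 0, …, 0)` all nonconstant solutions are
periodic with period `2π/L`. Printed proof (pp. 509–511): with `f = F ∘ x = x'`, `N = ‖f‖ ≠ 0`,
`y = f/N`, the Lipschitz bound gives `‖f'‖ ≤ L N` a.e. ((4)), hence `‖y'‖ ≤ L` ((5)), while the
unit tangent of a closed `C¹` curve turns by at least `2π` over one period, `∫₀ᵖ ‖y'‖ dt ≥ 2π`
(Lemma (6); Fenchel, Borsuk, Milnor for `C²` curves); so `2π ≤ Lp`.

Not recorded here: the Banach-space bounds `p ≥ 4/L` (Lasota–Yorke 1971) and `p ≥ 6/L`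
(Busenberg–Fisher–Martelli 1986). A shorter proof of the Euclidean/Hilbert bound, usable by a
literature-prover: `v = x'` is `p`-periodic with zero mean and Lipschitz with `‖v'‖ ≤ L‖v‖` a.e., so
Wirtinger's inequality `(2π/p)² ∫₀ᵖ ‖v‖² ≤ ∫₀ᵖ ‖v'‖² ≤ L² ∫₀ᵖ ‖v‖²` gives `2π/p ≤ L` once `v ≢ 0`
(the tree has the scalar `C¹` Wirtinger inequality `Literature.Analysis.Fourier.wirtinger`).

## Rendering

* `Rⁿ` with the Euclidean norm is `EuclideanSpace ℝ (Fin n)`; "(Euclidean) Lipschitz constant `L`"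
  on `Ω` is Mathlib's `LipschitzOnWith L F Ω` with `L : ℝ≥0` (for `L = 0` no nonconstant periodic
  solution exists, and the Lean right-hand side `2π/0 = 0 ≤ p` is harmless).
* "periodic solution of `x' = F(x)`": a global `C¹` curve `x : ℝ → Rⁿ` with values in `Ω`
  (`∀ t, x t ∈ Ω`, so that `F (x t)` is the printed value) and `HasDerivAt x (F (x t)) t` for all `t`.
* "nonconstant … with period `p`": `0 < p`, `Function.Periodic x p` and `∃ t₁ t₂, x t₁ ≠ x t₂`. The
  printed argument bounds EVERY positive period of a nonconstant solution (Lemma (6) is applied on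
  `[0, p]` for the given period), so `p` need not be the least period.

Mathlib / tree search (2026-08-15): no lower bound on periods of ODE solutions in Mathlib or the
tree (`lean search 'Yorke'` — only Hunt–Sauer–Yorke prevalence, Ott–Grebogi–Yorke, Lasota–Yorke;
`lean search --decl 'period.*[Ll]ipschitz'` — only `IsFlow.apply_add_period`); Mathlib supplies
`LipschitzOnWith`, `Function.Periodic`, `HasDerivAt`, `EuclideanSpace`.
-/

noncomputable section

namespace Literature.Analysis.ODE

/-- **Yorke's period bound** (Yorke 1969, Theorem, p. 509): if `F : Ω → Rⁿ` (`Ω ⊂ Rⁿ`, Euclidean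
norm) has Lipschitz constant `L` on `Ω`, `‖F(x₁) − F(x₂)‖ ≤ L‖x₁ − x₂‖` for `x₁, x₂ ∈ Ω`, then every
nonconstant periodic solution `x(t)` of `x' = F(x)` with period `p` has `p ≥ 2π/L`. Rendered for a
global `C¹` curve `x : ℝ → EuclideanSpace ℝ (Fin n)` with values in `Ω`, solving the equation at
every `t`, `p`-periodic with `0 < p` and not constant. Grounds the route item
`Summit.NavierStokesRegularity.NavierStokesRegularity.Theses.VortexLineClock.YorkePeriodBound`
(its case `n = 3`, `Ω = univ`, see `yorke1969_periodBound_fin3`).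
[cite: Yorke1969, Theorem (p. 509)] -/
def Yorke1969_periodBound : Prop :=
  ∀ (n : ℕ) (Ω : Set (EuclideanSpace ℝ (Fin n)))
    (F : EuclideanSpace ℝ (Fin n) → EuclideanSpace ℝ (Fin n)) (L : NNReal),
    LipschitzOnWith L F Ω →
    ∀ (x : ℝ → EuclideanSpace ℝ (Fin n)) (p : ℝ), 0 < p → (∀ t, x t ∈ Ω) →
      (∀ t, HasDerivAt x (F (x t)) t) → Function.Periodic x p → (∃ t₁ t₂, x t₁ ≠ x t₂) →
      2 * Real.pi / (L : ℝ) ≤ p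

/-- **Yorke's bound in `ℝ³`, non-stationary form** (derived from `Yorke1969_periodBound` with
`n = 3`, `Ω = univ`): for `F` globally `L`-Lipschitz on `ℝ³`, a `τ`-periodic (`τ > 0`) solution of
`x' = F(x)` through a point where `F ≠ 0` has `τ ≥ 2π/L` — a solution with `F (x 0) ≠ 0` is not
constant (a constant curve has derivative `0 = F (x 0)`). This is VERBATIM the support item
`YorkePeriodBound` of route NavierStokesRegularity/VortexLineClock, so that item is
`yorke1969_periodBound_fin3 h`. [cite: Yorke1969, Theorem (p. 509)] -/
theorem yorke1969_periodBound_fin3 (h : Yorke1969_periodBound) :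
    ∀ (F : EuclideanSpace ℝ (Fin 3) → EuclideanSpace ℝ (Fin 3)) (L : NNReal), LipschitzWith L F →
      ∀ (x : ℝ → EuclideanSpace ℝ (Fin 3)) (τ : ℝ), 0 < τ → (∀ s, HasDerivAt x (F (x s)) s) →
        (∀ s, x (s + τ) = x s) → F (x 0) ≠ 0 → 2 * Real.pi / (L : ℝ) ≤ τ := by
  intro F L hF x τ hτ hx hper hF0
  refine h 3 Set.univ F L hF.lipschitzOnWith x τ hτ (fun _ => Set.mem_univ _) hx hper ?_
  by_contra hconst
  push Not at hconst
  have hfun : x = fun _ => x 0 := funext fun t => hconst t 0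
  have hx0 : HasDerivAt x 0 0 := by
    rw [hfun]
    exact hasDerivAt_const (0 : ℝ) (x 0)
  exact hF0 ((hx 0).unique hx0)

end Literature.Analysis.ODE
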